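import Summits.CriticalPhenomena.CardyFormulaZ2.Theses.CardyBondTriangular

/-!
# Assembly of route `CardyBondTriangular` (sub-problem `CardyFormulaZ2`)

Item `stmt-CriticalPhenomena-4670`: the assembly statement
`BondTriangularCardy → TriangularToSquareTransport → DiscretisationBridge → CardyFormulaZ2`
of the route `route-CriticalPhenomena-CardyBondTriangular`.  It is pure modus ponens:
`BondTriangularCardy` is the hypothesis of `TriangularToSquareTransport` at
`Φ = cardyFunction`; its conclusion (Cardy for the crude `ℤ²` crossing event, per conformal
rectangle) is the hypothesis of `DiscretisationBridge`, whose conclusion is `CardyFormulaZ2`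
(per conformal rectangle).  This is exactly the body of the route's deciding theorem `closes`.
-/

namespace Summit.CriticalPhenomena.CardyFormulaZ2.Theorems

open Summit.CriticalPhenomena.CardyFormulaZ2.Theses

/-- **Assembly of the `CardyBondTriangular` route** (item `stmt-CriticalPhenomena-4670`):
the three route hypotheses `BondTriangularCardy`, `TriangularToSquareTransport`,
`DiscretisationBridge` imply `CardyFormulaZ2`, by modus ponens (the same term as the route's
deciding theorem `CardyBondTriangular.closes`): for a conformal rectangle `R`, apply the
bridge at `R` to the transported crossing limit `hTr cardyFunction hT R`. -/
theorem cardyBondTriangular_assembly_proof : CardyBondTriangular.Assembly := by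
  unfold CardyBondTriangular.Assembly
  intro hT hTr hB R
  exact hB R (hTr _ hT R)

end Summit.CriticalPhenomena.CardyFormulaZ2.Theorems
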